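import Literature.Geometry.Lorentzian.CoordChartLorentz
import Literature.Geometry.Lorentzian.ChartCalculus
import Literature.Geometry.Lorentzian.Basic
import HarnessLib

/-!
# Preparations for local developments built in a chart: open embeddings, Ricci-flatness of
# pullbacks, continuity of pairings of vector fields, the slice normal of an orientation with
# positive time component, reading a function in the chart at a point

Small, proved, general-purpose lemmas used when a local Cauchy development is constructed in the
target of a chart of the maximal atlas and transported back (Sbierski 2016, §3.2, proof of
Thm. 12; companion of `CoordChartLorentz.lean`, `CoordSlice.lean`):

* `CoordChart.isOpenEmbedding_inv` — the inverse chart `Ψ : ψ.target → M` is an open embedding;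
* `LorentzianMetric.isRicciFlat_comap` — `Ric(Φ^* g) = Φ^* Ric(g) = 0` for a Ricci-flat `g`
  (O'Neill 1983, Ch. 3, Prop. 3.59), any immersion `Φ` between equidimensional manifolds;
* `OpensChart.continuous_val_apply_of_contMDiff` — on a chart domain `T : Opens E`, the pairing
  `x ↦ g_x(Y x, Z x)` of two smooth vector fields is continuous; `OpensChart.mfderiv_clm_comp_val`
  (the differential of `x ↦ ℓ x` on `T` is `ℓ`), `OpensChart.contMDiff_clm_comp_val`;
* `OpensChart.isFutureDirected_sliceNormal_of_pos` — for a time-oriented Lorentzian metric on a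
  chart domain with representative `G`, at a point where the slices `{ℓ = const}` are spacelike
  (`lapseSq G ℓ > 0`) and the orienting vector has `ℓ(T) > 0`, the slice normal
  `N = -♯ℓ/√lapseSq` is future-directed: `G(T, N) = -ℓ(T)/√lapseSq < 0` (Wald 1984, (10.2.10));
* `hasFDerivAt_comp_chartAt_symm_of_contMDiffOn` — a function `C^∞` on an open set read in the
  preferred chart at a point of a boundaryless manifold modelled on `ℝᵐ`: `f ∘ (chartAt p₀)⁻¹` has
  at `chartAt p₀ p₀` the Fréchet derivative `ℓ` with `ℓ w = df_{p₀} w` (the input of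
  `Literature.Geometry.Manifold.exists_mem_maximalAtlas_apply_zero_eq`);
* `E4.norm_spatial_sub_lt_of_lens`, `E4.ofTimeSpace_mem_lens` — the trace of the lens
  `{‖x - a‖ < ρ ∧ |x 0| + k‖x - a‖ < kρ/2}` (`LocalCauchyLensShape.lean`) on the slice `{x⁰ = 0}`
  through `a` is the ball of radius `ρ/2` (Hawking–Ellis 1973, §7.4, Fig. 48).

Everything is proved; no definitions, no named facts (D-0026).

## References

* J. Sbierski, Ann. Henri Poincaré 17 (2016) 301–329 = arXiv:1309.7591, §3.2, proof of Thm. 12.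
* B. O'Neill, *Semi-Riemannian geometry with applications to relativity*, 1983, Ch. 3,
  Prop. 3.59; Ch. 5, Lemma 5.26 and p. 145. [ONeillSemiRiemannian1983]
* R. M. Wald, *General Relativity*, Chicago 1984, §10.2, (10.2.10). [Wald1984]
* S. W. Hawking, G. F. R. Ellis, *The large scale structure of space-time*, CUP 1973, §7.4.
-/

noncomputable section

open Bundle Set Function Filter TopologicalSpace Manifold Topology
open scoped Manifold ContDiff Topology

namespace Literature.Geometry.Lorentzian

/-! ### The inverse chart is an open embedding -/

namespace CoordChart

variable {m : ℕ} {M : Type*} [TopologicalSpace M] {ψ : OpenPartialHomeomorph M (EuclideanSpace ℝ (Fin m))}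

variable (ψ) in
/-- The inverse chart `Ψ : ψ.target → M` is an open embedding (the restriction of the open partial
homeomorphism `ψ⁻¹` to its source). [folklore] -/
theorem isOpenEmbedding_inv : IsOpenEmbedding (inv ψ) :=
  ψ.symm.isOpenEmbedding_restrict

/-- The inverse chart lands in the chart source. [folklore] -/
theorem range_inv_subset : range (inv ψ) ⊆ ψ.source := by
  rintro _ ⟨p, rfl⟩
  exact inv_mem_source p

end CoordChart

/-! ### Ricci-flatness of pullback metrics -/

section Comap

variable {E : Type*} [NormedAddCommGroup E] [NormedSpace ℝ E] {H : Type*} [TopologicalSpace H]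
  {I : ModelWithCorners ℝ E H} {M : Type*} [TopologicalSpace M] [ChartedSpace H M]
  [IsManifold I ∞ M]
  {E' : Type*} [NormedAddCommGroup E'] [NormedSpace ℝ E'] {H' : Type*} [TopologicalSpace H']
  {I' : ModelWithCorners ℝ E' H'} {N : Type*} [TopologicalSpace N] [ChartedSpace H' N]
  [IsManifold I' ∞ N] [FiniteDimensional ℝ E] [FiniteDimensional ℝ E']
  [CompleteSpace E] [CompleteSpace E']

/-- **The pullback of a Ricci-flat Lorentzian metric along an equidimensional immersion is
Ricci-flat**: `Ric(Φ^* g) = Φ^* Ric(g)` (O'Neill 1983, Ch. 3, Prop. 3.59,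
`PseudoRiemannianMetric.ricci_comap_apply`), for every proof of the standing Levi-Civita
hypotheses. [cite: ONeillSemiRiemannian1983, Ch. 3, Prop. 3.59] -/
theorem LorentzianMetric.isRicciFlat_comap (g : LorentzianMetric I ∞ M)
    (hpb : PseudoRiemannianMetric.contMDiff_pullbackBilin I M I' N ∞) {Φ : N → M}
    (hΦ : ContMDiff I' I (∞ + 1) Φ) (hΦ' : ∀ u, Injective (mfderiv I' I Φ u))
    (hdim : Module.finrank ℝ E' = Module.finrank ℝ E)
    [g.toPseudoRiemannianMetric.HasLeviCivita]
    [hLC : (g.comap hpb Φ hΦ hΦ' hdim).toPseudoRiemannianMetric.HasLeviCivita]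
    (hRic : g.toPseudoRiemannianMetric.IsRicciFlat) :
    (g.comap hpb Φ hΦ hΦ' hdim).toPseudoRiemannianMetric.IsRicciFlat := by
  haveI hLC' : (g.toPseudoRiemannianMetric.comap hpb Φ hΦ hΦ' hdim).HasLeviCivita := hLC
  intro u
  ext Y₀ Z₀
  have key : (g.comap hpb Φ hΦ hΦ' hdim).toPseudoRiemannianMetric.ricci u Y₀ Z₀ =
      g.toPseudoRiemannianMetric.ricci (Φ u) (mfderiv I' I Φ u Y₀) (mfderiv I' I Φ u Z₀) :=
    PseudoRiemannianMetric.ricci_comap_apply g.toPseudoRiemannianMetric hpb (Φ := Φ) hΦ hΦ' hdim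
      u Y₀ Z₀
  rw [key, hRic (Φ u)]
  rfl

end Comap

/-! ### Chart domains: pairings of smooth vector fields, linear coordinate functions -/

namespace OpensChart

variable {E : Type*} [NormedAddCommGroup E] [NormedSpace ℝ E] {T : Opens E} {n : ℕ∞ω}

/-- **A smooth vector field on a chart domain is continuous as a map to the model space** (the
tangent bundle of `T` is trivial, `OpensChart.contMDiffAt_section_iff`). [folklore] -/
theorem continuous_of_contMDiff_section {Y : Π x : T, TangentSpace 𝓘(ℝ, E) x}
    (hY : ContMDiff 𝓘(ℝ, E) 𝓘(ℝ, E).tangent ∞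
      (fun x ↦ (TotalSpace.mk' E x (Y x) : TangentBundle 𝓘(ℝ, E) T))) :
    Continuous (fun x : T ↦ (Y x : E)) := by
  have h : ContMDiff 𝓘(ℝ, E) 𝓘(ℝ, E) ∞ (fun x : T ↦ (Y x : E)) := fun x ↦
    (contMDiffAt_section_iff x Y).1 (hY x)
  exact h.continuous

/-- **The pairing of two smooth vector fields by a smooth metric on a chart domain is continuous**:
`x ↦ g_x(Y x, Z x)` with `g_x = G x`, `G` continuous on `T` (`contDiffAt_repr`) and `Y`, `Z`
continuous maps to the model space. [folklore] -/
theorem continuous_val_apply_of_contMDiff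
    {g : PseudoRiemannianMetric 𝓘(ℝ, E) ∞ E (TangentSpace 𝓘(ℝ, E) : T → Type _)}
    {G : E → E →L[ℝ] E →L[ℝ] ℝ} (hG : ∀ x : T, g.val x = G x)
    {Y Z : Π x : T, TangentSpace 𝓘(ℝ, E) x}
    (hY : ContMDiff 𝓘(ℝ, E) 𝓘(ℝ, E).tangent ∞
      (fun x ↦ (TotalSpace.mk' E x (Y x) : TangentBundle 𝓘(ℝ, E) T)))
    (hZ : ContMDiff 𝓘(ℝ, E) 𝓘(ℝ, E).tangent ∞
      (fun x ↦ (TotalSpace.mk' E x (Z x) : TangentBundle 𝓘(ℝ, E) T))) :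
    Continuous (fun x : T ↦ g.val x (Y x) (Z x)) := by
  have hGc : Continuous (fun x : T ↦ G x) := by
    refine continuous_iff_continuousAt.2 fun x ↦ ?_
    exact ((contDiffAt_repr hG x).continuousAt).comp continuous_subtype_val.continuousAt
  have hYc := continuous_of_contMDiff_section hY
  have hZc := continuous_of_contMDiff_section hZ
  have h : Continuous (fun x : T ↦ G x (Y x : E) (Z x : E)) :=
    (hGc.clm_apply hYc).clm_apply hZc
  refine h.congr fun x ↦ ?_
  exact (congrArg (fun B : TangentSpace 𝓘(ℝ, E) x →L[ℝ] TangentSpace 𝓘(ℝ, E) x →L[ℝ] ℝ ↦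
    B (Y x) (Z x)) (hG x)).symm

/-- A continuous linear form restricted to a chart domain is `C^n`. [folklore] -/
theorem contMDiff_clm_comp_val (ℓ : E →L[ℝ] ℝ) :
    ContMDiff 𝓘(ℝ, E) 𝓘(ℝ, ℝ) n (fun x : T ↦ ℓ (x : E)) :=
  (contMDiff_iff_contDiff.2 ℓ.contDiff).comp contMDiff_subtype_val

/-- **The differential of a linear coordinate function on a chart domain is the linear form**:
`d(x ↦ ℓ x)_x = ℓ`. [folklore] -/
theorem mfderiv_clm_comp_val (ℓ : E →L[ℝ] ℝ) (x : T) :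
    mfderiv 𝓘(ℝ, E) 𝓘(ℝ, ℝ) (fun y : T ↦ ℓ (y : E)) x = ℓ := by
  have h2 : (fun y : T ↦ ℓ (y : E)) = (ℓ : E → ℝ) ∘ (Subtype.val : T → E) := rfl
  rw [h2, mfderiv_comp x ℓ.hasMFDerivAt.mdifferentiableAt
    (hasMFDerivAt_subtypeVal (I' := 𝓘(ℝ, E)) x).mdifferentiableAt,
    ContinuousLinearMap.mfderiv_eq, mfderiv_subtypeVal]
  exact ContinuousLinearMap.comp_id _

/-- **The slice normal of the slicing by `ℓ` is future-directed where the orienting vector has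
positive `ℓ`-component.** For a time-oriented Lorentzian metric `(g, τ)` on a chart domain with
representative `G`, at a point `x` with `lapseSq G ℓ x > 0` (spacelike slices) and `ℓ(T(x)) > 0`,
the slice normal `N = -♯ℓ/√lapseSq` is a future-directed (unit timelike) vector:
`G(N, N) = -1` and `G(T, N) = G(N, T) = -ℓ(T)/√lapseSq < 0`. Wald 1984, §10.2, (10.2.10);
O'Neill 1983, Ch. 5, p. 145. [cite: Wald1984, §10.2, (10.2.10)] -/
theorem isFutureDirected_sliceNormal_of_pos {g : LorentzianMetric 𝓘(ℝ, E) n T}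
    (τ : TimeOrientation g) {G : E → E →L[ℝ] E →L[ℝ] ℝ}
    (hG : ∀ x : T, g.val x = G x) {ℓ : E →L[ℝ] ℝ} {x : T}
    (hinv : (G x).IsInvertible) (hpos : 0 < MetricCoord.lapseSq G ℓ x)
    (hT : 0 < ℓ (τ.vectorField x : E)) :
    τ.IsFutureDirected (x := x) (MetricCoord.sliceNormal G ℓ x : E) := by
  have key : ∀ u w : E, g.val x u w = G x u w := fun u w ↦
    congrArg (fun B : TangentSpace 𝓘(ℝ, E) x →L[ℝ] TangentSpace 𝓘(ℝ, E) x →L[ℝ] ℝ ↦ B u w) (hG x)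
  set N : E := MetricCoord.sliceNormal G ℓ x with hN
  have hunit : g.val x N N = -1 := by
    rw [key]
    exact MetricCoord.apply_sliceNormal_self hinv hpos
  refine ⟨⟨?_, ?_⟩, ?_⟩
  · show g.val x N N ≤ 0
    rw [hunit]
    norm_num
  · have h0 : N ≠ 0 := MetricCoord.sliceNormal_ne_zero hinv hpos
    exact h0
  · set T' : E := τ.vectorField x with hT'
    show g.val x T' N < 0
    rw [g.symm x, key, hN, MetricCoord.apply_sliceNormal hinv]
    have hs : 0 < (Real.sqrt (MetricCoord.lapseSq G ℓ x))⁻¹ := inv_pos.2 (Real.sqrt_pos.2 hpos)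
    have := mul_pos hs hT
    linarith

end OpensChart

/-! ### Reading a function in the preferred chart at a point -/

section ChartRead

variable {m : ℕ} {M : Type*} [TopologicalSpace M] [ChartedSpace (EuclideanSpace ℝ (Fin m)) M]
  [IsManifold (𝓡 m) ∞ M]

/-- **A smooth function read in the preferred chart.** If `f` is `C^∞` on an open `W ∋ p₀` of a
manifold modelled on `ℝᵐ` (charts `chartAt`), then `f ∘ (chartAt p₀)⁻¹` is `C^∞` at
`chartAt p₀ p₀` and its Fréchet derivative `ℓ` there reads the manifold differential:
`ℓ w = df_{p₀} w`. [folklore] -/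
theorem hasFDerivAt_comp_chartAt_symm_of_contMDiffOn {f : M → ℝ} {W : Set M} (hW : IsOpen W)
    {p₀ : M} (hp₀ : p₀ ∈ W) (hf : ContMDiffOn (𝓡 m) 𝓘(ℝ, ℝ) ∞ f W) :
    ContDiffAt ℝ ∞ (f ∘ (chartAt (EuclideanSpace ℝ (Fin m)) p₀).symm)
        (chartAt (EuclideanSpace ℝ (Fin m)) p₀ p₀) ∧
      HasFDerivAt (f ∘ (chartAt (EuclideanSpace ℝ (Fin m)) p₀).symm)
        (fderiv ℝ (f ∘ (chartAt (EuclideanSpace ℝ (Fin m)) p₀).symm)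
          (chartAt (EuclideanSpace ℝ (Fin m)) p₀ p₀))
        (chartAt (EuclideanSpace ℝ (Fin m)) p₀ p₀) ∧
      ∀ w : EuclideanSpace ℝ (Fin m),
        fderiv ℝ (f ∘ (chartAt (EuclideanSpace ℝ (Fin m)) p₀).symm)
          (chartAt (EuclideanSpace ℝ (Fin m)) p₀ p₀) w = mfderiv (𝓡 m) 𝓘(ℝ, ℝ) f p₀ w := by
  set φ := chartAt (EuclideanSpace ℝ (Fin m)) p₀ with hφ
  set x₀ : EuclideanSpace ℝ (Fin m) := φ p₀ with hx₀
  have hfa : ContMDiffAt (𝓡 m) 𝓘(ℝ, ℝ) ∞ f p₀ := (hf p₀ hp₀).contMDiffAt (hW.mem_nhds hp₀)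
  have hx₀t : x₀ ∈ φ.target := φ.map_source (mem_chart_source _ p₀)
  have hsymm₀ : φ.symm x₀ = p₀ := φ.left_inv (mem_chart_source _ p₀)
  -- `extChartAt = chartAt` for the model `𝓡 m`
  have hext : ∀ y, (extChartAt (𝓡 m) p₀).symm y = φ.symm y := fun y ↦ by
    simp [hφ]
  have hext' : extChartAt (𝓡 m) p₀ p₀ = x₀ := by simp [hx₀, hφ]
  -- smoothness of `F = f ∘ φ⁻¹` at `x₀`
  set F : EuclideanSpace ℝ (Fin m) → ℝ := f ∘ φ.symm with hF_def
  have hF : ContDiffAt ℝ ∞ F x₀ := by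
    have h1 : ContMDiffAt 𝓘(ℝ, EuclideanSpace ℝ (Fin m)) 𝓘(ℝ, ℝ) ∞ F x₀ := by
      have hs : ContMDiffAt 𝓘(ℝ, EuclideanSpace ℝ (Fin m)) (𝓡 m) ∞ φ.symm x₀ :=
        (contMDiffOn_chart_symm (I := 𝓡 m) (x := p₀) x₀ hx₀t).contMDiffAt
          (φ.open_target.mem_nhds hx₀t)
      have hfa' : ContMDiffAt (𝓡 m) 𝓘(ℝ, ℝ) ∞ f (φ.symm x₀) := by rw [hsymm₀]; exact hfa
      exact hfa'.comp x₀ hs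
    exact contMDiffAt_iff_contDiffAt.1 h1
  have hFd : HasFDerivAt F (fderiv ℝ F x₀) x₀ := (hF.differentiableAt (by simp)).hasFDerivAt
  refine ⟨hF, hFd, fun w ↦ ?_⟩
  -- `fderiv F x₀` reads `mfderiv f p₀`
  have hfd : MDifferentiableAt (𝓡 m) 𝓘(ℝ, ℝ) f p₀ := hfa.mdifferentiableAt (by simp)
  have e1 : mfderiv (𝓡 m) 𝓘(ℝ, ℝ) f p₀ w =
      fderivWithin ℝ (writtenInExtChartAt (𝓡 m) 𝓘(ℝ, ℝ) p₀ f) (range (𝓡 m))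
        (extChartAt (𝓡 m) p₀ p₀) w :=
    DFunLike.congr_fun hfd.mfderiv w
  have hw : writtenInExtChartAt (𝓡 m) 𝓘(ℝ, ℝ) p₀ f = F := by
    funext y
    show (extChartAt 𝓘(ℝ, ℝ) (f p₀)) (f ((extChartAt (𝓡 m) p₀).symm y)) = f (φ.symm y)
    rw [extChartAt_model_space_eq_id, hext]
    rfl
  have hrange : range (𝓡 m) = univ := ModelWithCorners.range_eq_univ (𝓡 m)
  rw [e1, hw, hrange, fderivWithin_univ, hext']

end ChartRead

/-! ### The trace of a lens on the slice through its centre -/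

namespace E4

/-- **A slice point of the lens lies over the half-radius ball**: if `a 0 = 0`, `x 0 = 0`,
`k > 0` and `|x 0| + k ‖x - a‖ < k ρ/2`, then `‖spatial x - spatial a‖ < ρ/2`. [folklore] -/
theorem norm_spatial_sub_lt_of_lens {a x : E4} (hx : x 0 = 0) {k ρ : ℝ} (hk : 0 < k)
    (h : |x 0| + k * ‖x - a‖ < k * (ρ / 2)) : ‖spatial x - spatial a‖ < ρ / 2 := by
  rw [hx, abs_zero, zero_add] at h
  have h1 : ‖x - a‖ < ρ / 2 := lt_of_mul_lt_mul_left h hk.le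
  have h2 : ‖spatial x - spatial a‖ ≤ ‖x - a‖ := by
    rw [← map_sub]
    have hsq : ‖x - a‖ ^ 2 = ((x - a) 0) ^ 2 + ‖spatial (x - a)‖ ^ 2 := by
      rw [EuclideanSpace.norm_sq_eq, EuclideanSpace.norm_sq_eq, Fin.sum_univ_succ]
      simp [spatial_apply]
    have h5 : ‖spatial (x - a)‖ ^ 2 ≤ ‖x - a‖ ^ 2 := by
      rw [hsq]
      nlinarith [sq_nonneg ((x - a) 0)]
    exact (pow_le_pow_iff_left₀ (norm_nonneg _) (norm_nonneg _) two_ne_zero).1 h5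
  exact h2.trans_lt h1

/-- **The slice over the half-radius ball lies in the lens**: if `a 0 = 0` and
`‖y - spatial a‖ < ρ/2`, then `x = (0, y)` satisfies `‖x - a‖ < ρ` and
`|x 0| + k ‖x - a‖ < k ρ/2` for every `k > 0`. [folklore] -/
theorem ofTimeSpace_mem_lens {a : E4} (ha : a 0 = 0) {y : E3} {k ρ : ℝ} (hk : 0 < k)
    (hy : ‖y - spatial a‖ < ρ / 2) :
    ‖ofTimeSpace 0 y - a‖ < ρ ∧
      |ofTimeSpace 0 y 0| + k * ‖ofTimeSpace 0 y - a‖ < k * (ρ / 2) := by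
  have hρ : 0 < ρ := by linarith [norm_nonneg (y - spatial a)]
  have ha' : ofTimeSpace 0 (spatial a) = a := by
    have h := ofTimeSpace_time_spatial a
    rw [time_apply, ha] at h
    exact h
  have hsub : ofTimeSpace 0 y - a = ofTimeSpace 0 (y - spatial a) := by
    conv_lhs => rw [← ha']
    ext i
    refine Fin.cases ?_ (fun j ↦ ?_) i
    · simp
    · simp
  have hnorm : ‖ofTimeSpace 0 y - a‖ = ‖y - spatial a‖ := by
    rw [hsub]
    have h3 := EuclideanSpace.norm_sq_eq (ofTimeSpace 0 (y - spatial a))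
    have h4 := EuclideanSpace.norm_sq_eq (y - spatial a)
    have h5 : ‖ofTimeSpace 0 (y - spatial a)‖ ^ 2 = ‖y - spatial a‖ ^ 2 := by
      rw [h3, h4, Fin.sum_univ_succ]
      simp
    exact (sq_eq_sq₀ (norm_nonneg _) (norm_nonneg _)).1 h5
  refine ⟨?_, ?_⟩
  · rw [hnorm]; linarith
  · rw [ofTimeSpace_apply_zero, abs_zero, zero_add, hnorm]
    exact mul_lt_mul_of_pos_left hy hk

end E4

end Literature.Geometry.Lorentzian

end
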